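import Mathlib
import Summits.ResolutionOfSingularities.ResolutionOfSingularities.Theorems.WildQuotientsWildQuotientResolutionJordanFiveRootChart0
import Summits.ResolutionOfSingularities.ResolutionOfSingularities.Theorems.WildQuotientsWildQuotientResolutionJordanFourHalfTransport
import Summits.ResolutionOfSingularities.ResolutionOfSingularities.Theorems.WildQuotientsWildQuotientResolutionJordanFiveFrameDefs
import Summits.ResolutionOfSingularities.ResolutionOfSingularities.Theorems.WildQuotientsWildQuotientResolutionSpanXComap

/-!
# RUNG V5 (`J₅`), brick `HP₀` ring side — tools for the chart-`0` (`μ₄`-vertex) ring model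

(crux stmt-ResolutionOfSingularities-15640 `WildQuotients.WildQuotientResolution`, line `Sketch`;
chain w45c RUNG V5, `JordanFive.exists_ringBrick_X0_model` (res-L1-w45c-plan-1 ORDERS
2026-08-27T12:39:07Z, β‴ design `L/w45c/HP0-ONESHOT-DESIGN.md` §4–§5; prover res-L1-w45c-stub-2).
[OURS · L1 W4.5c] — NOT a statement of any manuscript; replaces the role of no printed item. Def-free.)

Root chart `U₀ = k[ρ, y₁, …, y₄, passengers]` at the `μ₄`-vertex (slots `ρ = X a`, `y₁ = X b`, `y₂ = X c`,
`y₃ = X d`, `y₄ = X e`), res-type-036's slot substitution `θ₅ : X b ↦ N, X c ↦ γ₂″, X d ↦ γ₃″, X e ↦ γ₄″`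
(`JordanFive.chart0_fixedPoints_eq_map`, p525294).

* `surjective_of_forall_X` — an algebra endomorphism of `R[x_σ]` hitting every variable is onto;
* `slotSubst5_eq_comp_substN`, `slotSubst5_injective` — `θ₅ = ψ ∘ S_N` with `ψ` res-type-036's slice
  automorphism (`rootChart5_subst_surjective`) and `S_N = JordanFour.substN k n a b p`; `θ₅` injective;
* `comap_slotSubst5_span_X_abd`, `comap_slotSubst5_span_X_abcd` — **`θ₅⁻¹⟨x_a, x_b, x_d⟩ = ⟨x_a, x_b, x_d⟩`**
  and **`θ₅⁻¹⟨x_a, x_b, x_c, x_d⟩ = ⟨x_a, x_b, x_c, x_d⟩`** (`SpanX.comap_span_X_eq_of_kill_comp` with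
  `τ : X c ↦ 2X c, X e ↦ 4X e − 2X c²` resp. `X e ↦ 4X e`, automorphisms as `2 ∈ kˣ`);
* `exps12_table` — per generator `g_j = x_a^α x_b^β x_c^γ x_d^δ`: `4α + 3β + 2γ + δ ≥ 12`,
  `j ∉ {0,2,5,13} ⇒ β ≠ 0 ∨ δ ≠ 0`, `j ≠ 0 ⇒ β ≠ 0 ∨ γ ≠ 0 ∨ δ ≠ 0` (kernel-decided);
* `rootRatio_mem_span_X_abd/abcd` — the ratio values lie in `⟨x_a,x_b,x_d⟩` off `{0,2,5,13}`,
  in `⟨x_a,…,x_d⟩` off `0`;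
* `root5_X_a/b/c/d`, `aeval_root5_gens12` — the root substitution on the variables and `ψ₀(g_j) = x_a^{12} · (x_a^{4α+3β+2γ+δ−12} x_b^β x_c^γ x_d^δ)` for the root
  substitution `ψ₀`.
-/

-- single-problem summit: the doubled namespace component `ResolutionOfSingularities` is forced
set_option linter.dupNamespace false

noncomputable section

open MvPolynomial

namespace Summit.ResolutionOfSingularities.ResolutionOfSingularities.Theorems.WildQuotientResolution.JordanFive

/-! ## A generic fact -/

/-- An algebra endomorphism of a polynomial ring hitting every variable is surjective. [folklore] -/
theorem surjective_of_forall_X {σ R : Type*} [CommRing R] (ψ : MvPolynomial σ R →ₐ[R] MvPolynomial σ R)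
    (hX : ∀ i, ∃ q, ψ q = X i) : Function.Surjective ψ := by
  intro f
  induction f using MvPolynomial.induction_on with
  | C r => exact ⟨C r, ψ.commutes r⟩
  | add p q hp hq =>
    obtain ⟨p', hp'⟩ := hp
    obtain ⟨q', hq'⟩ := hq
    exact ⟨p' + q', by rw [map_add, hp', hq']⟩
  | mul_X p i hp =>
    obtain ⟨p', hp'⟩ := hp
    obtain ⟨q, hq⟩ := hX i
    exact ⟨p' * q, by rw [map_mul, hp', hq]⟩

/-! ## The slot substitution `θ₅` -/

section Slot

variable (k : Type) [Field k] (n : ℕ) (a b c d e : Fin n) (p : ℕ)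

/-- res-type-036's slot substitution datum (`Chart0Fixed`): `X b ↦ N`, `X c ↦ γ₂″`, `X d ↦ γ₃″`,
`X e ↦ γ₄″`, other variables fixed. -/
local notation3 "g₅" => (fun i : Fin n => if i = b then X b ^ p - X a ^ (p - 1) * X b
    else if i = c then 2 * X c - X b ^ 2 + X a * X b
    else if i = d then 3 * X d - 3 * (X b * X c) + X b ^ 3 - X a * X b ^ 2 + 2 * (X a * X c)
    else if i = e then 4 * X e - 4 * (X b * X d) - 2 * X c ^ 2 + 4 * (X b ^ 2 * X c) - X b ^ 4
      + X a * X b ^ 3 - 3 * (X a * X b * X c) + 3 * (X a * X d)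
    else (X i : MvPolynomial (Fin n) k))
/-- res-type-036's slice substitution datum (`RootChart0`): `X c ↦ γ₂″`, `X d ↦ γ₃″`, `X e ↦ γ₄″`. -/
local notation3 "gψ" => (fun i : Fin n => if i = c then 2 * X c - X b ^ 2 + X a * X b
    else if i = d then 3 * X d - 3 * (X b * X c) + X b ^ 3 - X a * X b ^ 2 + 2 * (X a * X c)
    else if i = e then 4 * X e - 4 * (X b * X d) - 2 * X c ^ 2 + 4 * (X b ^ 2 * X c) - X b ^ 4
      + X a * X b ^ 3 - 3 * (X a * X b * X c) + 3 * (X a * X d)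
    else (X i : MvPolynomial (Fin n) k))

variable (hab : a ≠ b) (hac : a ≠ c) (had : a ≠ d) (hae : a ≠ e) (hbc : b ≠ c) (hbd : b ≠ d)
  (hbe : b ≠ e) (hcd : c ≠ d) (hce : c ≠ e) (hde : d ≠ e)

include hab hac had hae in
/-- `θ₅ (x_a) = x_a`. [OURS · L1 W4.5c] -/
theorem slotSubst5_X_a : aeval g₅ (X a : MvPolynomial (Fin n) k) = X a := by
  rw [aeval_X]; simp [hab, hac, had, hae]

/-- `θ₅ (x_b) = N`. [OURS · L1 W4.5c] -/
theorem slotSubst5_X_b :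
    aeval g₅ (X b : MvPolynomial (Fin n) k) = X b ^ p - X a ^ (p - 1) * X b := by
  rw [aeval_X]; simp

include hbc in
/-- `θ₅ (x_c) = γ₂″`. [OURS · L1 W4.5c] -/
theorem slotSubst5_X_c :
    aeval g₅ (X c : MvPolynomial (Fin n) k) = 2 * X c - X b ^ 2 + X a * X b := by
  rw [aeval_X]; simp [hbc.symm]

include hbd hcd in
/-- `θ₅ (x_d) = γ₃″`. [OURS · L1 W4.5c] -/
theorem slotSubst5_X_d :
    aeval g₅ (X d : MvPolynomial (Fin n) k) =
      3 * X d - 3 * (X b * X c) + X b ^ 3 - X a * X b ^ 2 + 2 * (X a * X c) := by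
  rw [aeval_X]; simp [hbd.symm, hcd.symm]

include hbe hce hde in
/-- `θ₅ (x_e) = γ₄″`. [OURS · L1 W4.5c] -/
theorem slotSubst5_X_e :
    aeval g₅ (X e : MvPolynomial (Fin n) k) = 4 * X e - 4 * (X b * X d) - 2 * X c ^ 2
      + 4 * (X b ^ 2 * X c) - X b ^ 4 + X a * X b ^ 3 - 3 * (X a * X b * X c) + 3 * (X a * X d) := by
  rw [aeval_X]; simp [hbe.symm, hce.symm, hde.symm]

/-- `θ₅ (x_i) = x_i` for the other variables. [OURS · L1 W4.5c] -/
theorem slotSubst5_X_of_ne {i : Fin n} (h1 : i ≠ b) (h2 : i ≠ c) (h3 : i ≠ d) (h4 : i ≠ e) :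
    aeval g₅ (X i : MvPolynomial (Fin n) k) = X i := by
  rw [aeval_X]; simp [h1, h2, h3, h4]

include hab hac had hae hbc hbd hbe hcd hce hde in
/-- **`θ₅ = ψ ∘ S_N`**: the slot substitution is the slice automorphism after the Artin–Schreier
substitution `S_N : X b ↦ X b^p − X a^{p−1} X b` (`JordanFour.substN k n a b p`). [OURS · L1 W4.5c] -/
theorem slotSubst5_eq_comp_substN :
    (aeval g₅ : MvPolynomial (Fin n) k →ₐ[k] MvPolynomial (Fin n) k) =
      (aeval gψ).comp (JordanFour.substN k n a b p) := by
  have hθa := slotSubst5_X_a k n a b c d e p hab hac had hae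
  have hθb := slotSubst5_X_b k n a b c d e p
  have hθc := slotSubst5_X_c k n a b c d e p hbc
  have hθd := slotSubst5_X_d k n a b c d e p hbd hcd
  have hθe := slotSubst5_X_e k n a b c d e p hbe hce hde
  have hθi : ∀ i, i ≠ b → i ≠ c → i ≠ d → i ≠ e → aeval g₅ (X i : MvPolynomial (Fin n) k) = X i :=
    fun i h1 h2 h3 h4 => slotSubst5_X_of_ne k n a b c d e p h1 h2 h3 h4
  have hψa : aeval gψ (X a : MvPolynomial (Fin n) k) = X a := by rw [aeval_X]; simp [hac, had, hae]
  have hψb : aeval gψ (X b : MvPolynomial (Fin n) k) = X b := by rw [aeval_X]; simp [hbc, hbd, hbe]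
  refine MvPolynomial.algHom_ext fun i => ?_
  rw [AlgHom.comp_apply]
  by_cases hib : i = b
  · rw [hib, hθb, JordanFour.substN_X_self, map_sub, map_mul, map_pow, map_pow, hψa, hψb]
  · rw [JordanFour.substN_X_of_ne k n a b p hib, aeval_X, aeval_X]
    simp [hib]

include hab hac had hae hbc hbd hbe hcd hce hde in
/-- **`θ₅` is injective** (`p` prime, `p ≥ 5`, `char k = p`): `ψ` is onto hence injective
(`ToricExit.rootChart5_subst_surjective`, `ToricExit.algHom_injective_of_surjective`) and `S_N` is
injective (`JordanFour.substN_injective`). [OURS · L1 W4.5c] -/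
theorem slotSubst5_injective (hp5 : 5 ≤ p) [CharP k p] :
    Function.Injective (aeval g₅ : MvPolynomial (Fin n) k →ₐ[k] MvPolynomial (Fin n) k) := by
  have h2 : (2 : k) ≠ 0 := JordanFour.two_ne_zero_of_charP k p hp5
  have h3 : (3 : k) ≠ 0 := JordanFour.three_ne_zero_of_charP k p hp5
  rw [slotSubst5_eq_comp_substN k n a b c d e p hab hac had hae hbc hbd hbe hcd hce hde, AlgHom.coe_comp]
  refine Function.Injective.comp ?_ (JordanFour.substN_injective k n a b p hab (by omega))
  exact ToricExit.algHom_injective_of_surjective k n _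
    (ToricExit.rootChart5_subst_surjective k n a b c d e hac had hae hbc hbd hbe h2 h3 _
      (by simp) (by simp [hcd.symm]) (by simp [hce.symm, hde.symm])
      (fun i hic hid hie => by simp [hic, hid, hie]))

include hab hac had hae hbc hbd hbe hcd hce hde in
/-- **`θ₅⁻¹ ⟨x_a, x_b, x_d⟩ = ⟨x_a, x_b, x_d⟩`** (`2 ∈ kˣ`): killing `x_a, x_b, x_d` after `θ₅` is
`τ ∘ kill` with `τ : X c ↦ 2X c, X e ↦ 4X e − 2X c²` an automorphism. [OURS · L1 W4.5c] -/
theorem comap_slotSubst5_span_X_abd (hp : p.Prime) (hp5 : 5 ≤ p) [CharP k p] :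
    (Ideal.span (X '' ({a, b, d} : Set (Fin n)) : Set (MvPolynomial (Fin n) k))).comap
      (aeval g₅ : MvPolynomial (Fin n) k →ₐ[k] MvPolynomial (Fin n) k) =
      Ideal.span (X '' ({a, b, d} : Set (Fin n))) := by
  classical
  have hθa := slotSubst5_X_a k n a b c d e p hab hac had hae
  have hθb := slotSubst5_X_b k n a b c d e p
  have hθc := slotSubst5_X_c k n a b c d e p hbc
  have hθd := slotSubst5_X_d k n a b c d e p hbd hcd
  have hθe := slotSubst5_X_e k n a b c d e p hbe hce hde
  have hθi : ∀ i, i ≠ b → i ≠ c → i ≠ d → i ≠ e → aeval g₅ (X i : MvPolynomial (Fin n) k) = X i :=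
    fun i h1 h2 h3 h4 => slotSubst5_X_of_ne k n a b c d e p h1 h2 h3 h4
  have h2 : (2 : k) ≠ 0 := JordanFour.two_ne_zero_of_charP k p hp5
  have h4 : (4 : k) ≠ 0 := by
    rw [show (4 : k) = 2 * 2 by norm_num]; exact mul_ne_zero h2 h2
  have h2C : (2 : MvPolynomial (Fin n) k) * C (2⁻¹ : k) = 1 := JordanFour.two_mul_C_inv_two k n h2
  have h4C : (4 : MvPolynomial (Fin n) k) * C (4⁻¹ : k) = 1 := by
    rw [← map_ofNat C 4, ← map_mul, mul_inv_cancel₀ h4, map_one]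
  let τ : MvPolynomial (Fin n) k →ₐ[k] MvPolynomial (Fin n) k :=
    aeval fun i => if i = c then 2 * X c else if i = e then 4 * X e - 2 * X c ^ 2 else X i
  have hτC : ∀ r : k, τ (C r) = C r := fun r => τ.commutes r
  have hτc : τ (X c) = 2 * X c := by simp [τ]
  have hτe : τ (X e) = 4 * X e - 2 * X c ^ 2 := by simp [τ, hce.symm]
  have hτi : ∀ i, i ≠ c → i ≠ e → τ (X i) = X i := fun i hic hie => by simp [τ, hic, hie]
  have hτinj : Function.Injective τ := by
    refine ToricExit.algHom_injective_of_surjective k n τ (surjective_of_forall_X τ fun i => ?_)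
    by_cases hic : i = c
    · refine ⟨C (2⁻¹ : k) * X c, ?_⟩
      rw [hic, map_mul, hτc, hτC]
      linear_combination (X c : MvPolynomial (Fin n) k) * h2C
    · by_cases hie : i = e
      · refine ⟨C (4⁻¹ : k) * (X e + 2 * (C (2⁻¹ : k) * X c) ^ 2), ?_⟩
        rw [hie, map_mul, map_add, map_mul, map_pow, map_mul, hτe, hτc, hτC, hτC, map_ofNat]
        linear_combination (X e : MvPolynomial (Fin n) k) * h4C +
          C (4⁻¹ : k) * 2 * X c ^ 2 * (2 * C (2⁻¹ : k) + 1) * h2C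
      · exact ⟨X i, hτi i hic hie⟩
  set κ : MvPolynomial (Fin n) k →ₐ[k] MvPolynomial (Fin n) k :=
    aeval (fun i => if i ∈ ({a, b, d} : Set (Fin n)) then (0 : MvPolynomial (Fin n) k) else X i) with hκ
  have hκX : ∀ i, κ (X i) = if i ∈ ({a, b, d} : Set (Fin n)) then (0 : MvPolynomial (Fin n) k) else X i :=
    fun i => by rw [hκ, aeval_X]
  have hκa : κ (X a) = 0 := by rw [hκX]; simp
  have hκb : κ (X b) = 0 := by rw [hκX]; simp
  have hκd : κ (X d) = 0 := by rw [hκX]; simp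
  have hκc : κ (X c) = X c := by rw [hκX]; simp [hac.symm, hbc.symm, hcd]
  have hκe : κ (X e) = X e := by rw [hκX]; simp [hae.symm, hbe.symm, hde.symm]
  have hκi : ∀ i, i ≠ a → i ≠ b → i ≠ d → κ (X i) = X i := fun i h1 h2 h3 => by
    rw [hκX]; simp [h1, h2, h3]
  refine SpanX.comap_span_X_eq_of_kill_comp ({a, b, d} : Set (Fin n)) (aeval g₅) τ hτinj fun i => ?_
  change κ (aeval g₅ (X i)) = τ (κ (X i))
  by_cases hia : i = a
  · rw [hia, hθa, hκa, map_zero]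
  by_cases hib : i = b
  · rw [hib, hθb, map_sub, map_mul, map_pow, map_pow, hκa, hκb, map_zero, mul_zero, sub_zero,
      zero_pow hp.ne_zero]
  by_cases hic : i = c
  · rw [hic, hθc, hκc, hτc]
    simp only [map_sub, map_add, map_mul, map_pow, map_ofNat, hκa, hκb, hκc]
    ring
  by_cases hid : i = d
  · rw [hid, hθd, hκd, map_zero]
    simp only [map_sub, map_add, map_mul, map_pow, map_ofNat, hκa, hκb, hκc, hκd]
    ring
  by_cases hie : i = e
  · rw [hie, hθe, hκe, hτe]
    simp only [map_sub, map_add, map_mul, map_pow, map_ofNat, hκa, hκb, hκc, hκd, hκe]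
    ring
  · rw [hθi i hib hic hid hie, hκi i hia hib hid, hτi i hic hie]

include hab hac had hae hbc hbd hbe hcd hce hde in
/-- **`θ₅⁻¹ ⟨x_a, x_b, x_c, x_d⟩ = ⟨x_a, x_b, x_c, x_d⟩`** (`2 ∈ kˣ`): killing `x_a, …, x_d` after `θ₅`
is `τ ∘ kill` with `τ : X e ↦ 4X e` an automorphism. [OURS · L1 W4.5c] -/
theorem comap_slotSubst5_span_X_abcd (hp : p.Prime) (hp5 : 5 ≤ p) [CharP k p] :
    (Ideal.span (X '' ({a, b, c, d} : Set (Fin n)) : Set (MvPolynomial (Fin n) k))).comap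
      (aeval g₅ : MvPolynomial (Fin n) k →ₐ[k] MvPolynomial (Fin n) k) =
      Ideal.span (X '' ({a, b, c, d} : Set (Fin n))) := by
  classical
  have hθa := slotSubst5_X_a k n a b c d e p hab hac had hae
  have hθb := slotSubst5_X_b k n a b c d e p
  have hθc := slotSubst5_X_c k n a b c d e p hbc
  have hθd := slotSubst5_X_d k n a b c d e p hbd hcd
  have hθe := slotSubst5_X_e k n a b c d e p hbe hce hde
  have hθi : ∀ i, i ≠ b → i ≠ c → i ≠ d → i ≠ e → aeval g₅ (X i : MvPolynomial (Fin n) k) = X i :=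
    fun i h1 h2 h3 h4 => slotSubst5_X_of_ne k n a b c d e p h1 h2 h3 h4
  have h2 : (2 : k) ≠ 0 := JordanFour.two_ne_zero_of_charP k p hp5
  have h4 : (4 : k) ≠ 0 := by
    rw [show (4 : k) = 2 * 2 by norm_num]; exact mul_ne_zero h2 h2
  have h4C : (4 : MvPolynomial (Fin n) k) * C (4⁻¹ : k) = 1 := by
    rw [← map_ofNat C 4, ← map_mul, mul_inv_cancel₀ h4, map_one]
  let τ : MvPolynomial (Fin n) k →ₐ[k] MvPolynomial (Fin n) k :=
    aeval fun i => if i = e then 4 * X e else X i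
  have hτC : ∀ r : k, τ (C r) = C r := fun r => τ.commutes r
  have hτe : τ (X e) = 4 * X e := by simp [τ]
  have hτi : ∀ i, i ≠ e → τ (X i) = X i := fun i hie => by simp [τ, hie]
  have hτinj : Function.Injective τ := by
    refine ToricExit.algHom_injective_of_surjective k n τ (surjective_of_forall_X τ fun i => ?_)
    by_cases hie : i = e
    · refine ⟨C (4⁻¹ : k) * X e, ?_⟩
      rw [hie, map_mul, hτe, hτC]
      linear_combination (X e : MvPolynomial (Fin n) k) * h4C
    · exact ⟨X i, hτi i hie⟩
  set κ : MvPolynomial (Fin n) k →ₐ[k] MvPolynomial (Fin n) k :=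
    aeval (fun i => if i ∈ ({a, b, c, d} : Set (Fin n)) then (0 : MvPolynomial (Fin n) k) else X i) with hκ
  have hκX : ∀ i, κ (X i) = if i ∈ ({a, b, c, d} : Set (Fin n)) then (0 : MvPolynomial (Fin n) k) else X i :=
    fun i => by rw [hκ, aeval_X]
  have hκa : κ (X a) = 0 := by rw [hκX]; simp
  have hκb : κ (X b) = 0 := by rw [hκX]; simp
  have hκc : κ (X c) = 0 := by rw [hκX]; simp
  have hκd : κ (X d) = 0 := by rw [hκX]; simp
  have hκe : κ (X e) = X e := by rw [hκX]; simp [hae.symm, hbe.symm, hce.symm, hde.symm]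
  have hκi : ∀ i, i ≠ a → i ≠ b → i ≠ c → i ≠ d → κ (X i) = X i := fun i h1 h2 h3 h4 => by
    rw [hκX]; simp [h1, h2, h3, h4]
  refine SpanX.comap_span_X_eq_of_kill_comp ({a, b, c, d} : Set (Fin n)) (aeval g₅) τ hτinj fun i => ?_
  change κ (aeval g₅ (X i)) = τ (κ (X i))
  by_cases hia : i = a
  · rw [hia, hθa, hκa, map_zero]
  by_cases hib : i = b
  · rw [hib, hθb, map_sub, map_mul, map_pow, map_pow, hκa, hκb, map_zero, mul_zero, sub_zero,
      zero_pow hp.ne_zero]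
  by_cases hic : i = c
  · rw [hic, hθc, hκc, map_zero]
    simp only [map_sub, map_add, map_mul, map_pow, map_ofNat, hκa, hκb, hκc]
    ring
  by_cases hid : i = d
  · rw [hid, hθd, hκd, map_zero]
    simp only [map_sub, map_add, map_mul, map_pow, map_ofNat, hκa, hκb, hκc, hκd]
    ring
  by_cases hie : i = e
  · rw [hie, hθe, hκe, hτe]
    simp only [map_sub, map_add, map_mul, map_pow, map_ofNat, hκa, hκb, hκc, hκd, hκe]
    ring
  · rw [hθi i hib hic hid hie, hκi i hia hib hic hid, hτi i hie]

end Slot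

/-! ## The root substitution on the generators of `I₁₂` -/

section Root

variable (k : Type) [Field k] (n : ℕ) (a b c d : Fin n)

/-- The exponent table of `I₁₂`: `4α + 3β + 2γ + δ ≥ 12`; off `{0,2,5,13}` one of `β, δ` is positive;
off `0` one of `β, γ, δ` is positive. [OURS · L1 W4.5c] -/
theorem exps12_table : ∀ j : Fin 40,
    12 ≤ 4 * (exps12 j).1 + 3 * (exps12 j).2.1 + 2 * (exps12 j).2.2.1 + (exps12 j).2.2.2 ∧
    ((j ≠ 0 ∧ j ≠ 2 ∧ j ≠ 5 ∧ j ≠ 13) → ((exps12 j).2.1 ≠ 0 ∨ (exps12 j).2.2.2 ≠ 0)) ∧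
    (j ≠ 0 → ((exps12 j).2.1 ≠ 0 ∨ (exps12 j).2.2.1 ≠ 0 ∨ (exps12 j).2.2.2 ≠ 0)) := by
  decide

variable (hab : a ≠ b) (hac : a ≠ c) (had : a ≠ d) (hbc : b ≠ c) (hbd : b ≠ d) (hcd : c ≠ d)

/-- `ψ₀ (x_a) = x_a⁴`. [OURS · L1 W4.5c] -/
theorem root5_X_a :
    aeval (fun i : Fin n => if i = a then X a ^ 4 else if i = b then X a ^ 3 * X b
        else if i = c then X a ^ 2 * X c else if i = d then X a * X d else (X i : MvPolynomial (Fin n) k))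
      (X a : MvPolynomial (Fin n) k) = X a ^ 4 := by
  rw [aeval_X]; simp

include hab in
/-- `ψ₀ (x_b) = x_a³ x_b`. [OURS · L1 W4.5c] -/
theorem root5_X_b :
    aeval (fun i : Fin n => if i = a then X a ^ 4 else if i = b then X a ^ 3 * X b
        else if i = c then X a ^ 2 * X c else if i = d then X a * X d else (X i : MvPolynomial (Fin n) k))
      (X b : MvPolynomial (Fin n) k) = X a ^ 3 * X b := by
  rw [aeval_X]; simp [hab.symm]

include hac hbc in
/-- `ψ₀ (x_c) = x_a² x_c`. [OURS · L1 W4.5c] -/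
theorem root5_X_c :
    aeval (fun i : Fin n => if i = a then X a ^ 4 else if i = b then X a ^ 3 * X b
        else if i = c then X a ^ 2 * X c else if i = d then X a * X d else (X i : MvPolynomial (Fin n) k))
      (X c : MvPolynomial (Fin n) k) = X a ^ 2 * X c := by
  rw [aeval_X]; simp [hac.symm, hbc.symm]

include had hbd hcd in
/-- `ψ₀ (x_d) = x_a x_d`. [OURS · L1 W4.5c] -/
theorem root5_X_d :
    aeval (fun i : Fin n => if i = a then X a ^ 4 else if i = b then X a ^ 3 * X b
        else if i = c then X a ^ 2 * X c else if i = d then X a * X d else (X i : MvPolynomial (Fin n) k))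
      (X d : MvPolynomial (Fin n) k) = X a * X d := by
  rw [aeval_X]; simp [had.symm, hbd.symm, hcd.symm]

include hab hac had hbc hbd hcd in
/-- **The root substitution on a generator**: with `g_j = x_a^α x_b^β x_c^γ x_d^δ` and
`N = 4α + 3β + 2γ + δ − 12`,
`ψ₀(g_j) = x_a^{12} · (x_a^N x_b^β x_c^γ x_d^δ)` for `ψ₀ : x_a ↦ x_a⁴, x_b ↦ x_a³x_b, x_c ↦ x_a²x_c,
x_d ↦ x_ax_d`. [OURS · L1 W4.5c] -/
theorem aeval_root5_gens12 (j : Fin 40) :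
    aeval (fun i : Fin n => if i = a then X a ^ 4 else if i = b then X a ^ 3 * X b
        else if i = c then X a ^ 2 * X c else if i = d then X a * X d else (X i : MvPolynomial (Fin n) k))
      (gens12 k n a b c d j) =
      X a ^ 12 * (X a ^ (4 * (exps12 j).1 + 3 * (exps12 j).2.1 + 2 * (exps12 j).2.2.1 + (exps12 j).2.2.2 - 12) *
        X b ^ (exps12 j).2.1 * X c ^ (exps12 j).2.2.1 * X d ^ (exps12 j).2.2.2) := by
  obtain ⟨h12, -, -⟩ := exps12_table j
  rw [gens12_eq_monomial]
  generalize (exps12 j).1 = α at h12 ⊢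
  generalize (exps12 j).2.1 = β at h12 ⊢
  generalize (exps12 j).2.2.1 = γ at h12 ⊢
  generalize (exps12 j).2.2.2 = δ at h12 ⊢
  obtain ⟨N, hN⟩ : ∃ N, 4 * α + 3 * β + 2 * γ + δ = N + 12 := ⟨_, (Nat.sub_add_cancel h12).symm⟩
  rw [hN, Nat.add_sub_cancel]
  simp only [map_mul, map_pow, root5_X_a k n a b c d, root5_X_b k n a b c d hab,
    root5_X_c k n a b c d hac hbc, root5_X_d k n a b c d had hbd hcd]
  calc _ = (X a : MvPolynomial (Fin n) k) ^ (4 * α + 3 * β + 2 * γ + δ) * (X b ^ β * X c ^ γ * X d ^ δ) := by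
        ring
    _ = X a ^ (N + 12) * (X b ^ β * X c ^ γ * X d ^ δ) := by rw [hN]
    _ = _ := by ring

/-- Off `{0,2,5,13}` the ratio value `x_a^N x_b^β x_c^γ x_d^δ` lies in `⟨x_a, x_b, x_d⟩`. [OURS · L1 W4.5c] -/
theorem rootRatio_mem_span_X_abd (j : Fin 40) (hj : j ≠ 0 ∧ j ≠ 2 ∧ j ≠ 5 ∧ j ≠ 13) :
    (X a ^ (4 * (exps12 j).1 + 3 * (exps12 j).2.1 + 2 * (exps12 j).2.2.1 + (exps12 j).2.2.2 - 12) *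
        X b ^ (exps12 j).2.1 * X c ^ (exps12 j).2.2.1 * X d ^ (exps12 j).2.2.2 : MvPolynomial (Fin n) k) ∈
      Ideal.span (X '' ({a, b, d} : Set (Fin n))) := by
  have hXmem : ∀ i : Fin n, i ∈ ({a, b, d} : Set (Fin n)) → ∀ m, m ≠ 0 →
      (X i : MvPolynomial (Fin n) k) ^ m ∈ Ideal.span (X '' ({a, b, d} : Set (Fin n))) :=
    fun i hi m hm => Ideal.pow_mem_of_mem _ (Ideal.subset_span (Set.mem_image_of_mem X hi)) _
      (Nat.pos_of_ne_zero hm)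
  rcases (exps12_table j).2.1 hj with hβ | hδ
  · exact Ideal.mul_mem_right _ _ (Ideal.mul_mem_right _ _ (Ideal.mul_mem_left _ _ (hXmem b (by simp) _ hβ)))
  · exact Ideal.mul_mem_left _ _ (hXmem d (by simp) _ hδ)

/-- Off `0` the ratio value `x_a^N x_b^β x_c^γ x_d^δ` lies in `⟨x_a, x_b, x_c, x_d⟩`. [OURS · L1 W4.5c] -/
theorem rootRatio_mem_span_X_abcd (j : Fin 40) (hj : j ≠ 0) :
    (X a ^ (4 * (exps12 j).1 + 3 * (exps12 j).2.1 + 2 * (exps12 j).2.2.1 + (exps12 j).2.2.2 - 12) *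
        X b ^ (exps12 j).2.1 * X c ^ (exps12 j).2.2.1 * X d ^ (exps12 j).2.2.2 : MvPolynomial (Fin n) k) ∈
      Ideal.span (X '' ({a, b, c, d} : Set (Fin n))) := by
  have hXmem : ∀ i : Fin n, i ∈ ({a, b, c, d} : Set (Fin n)) → ∀ m, m ≠ 0 →
      (X i : MvPolynomial (Fin n) k) ^ m ∈ Ideal.span (X '' ({a, b, c, d} : Set (Fin n))) :=
    fun i hi m hm => Ideal.pow_mem_of_mem _ (Ideal.subset_span (Set.mem_image_of_mem X hi)) _
      (Nat.pos_of_ne_zero hm)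
  rcases (exps12_table j).2.2 hj with hβ | hγ | hδ
  · exact Ideal.mul_mem_right _ _ (Ideal.mul_mem_right _ _ (Ideal.mul_mem_left _ _ (hXmem b (by simp) _ hβ)))
  · exact Ideal.mul_mem_right _ _ (Ideal.mul_mem_left _ _ (hXmem c (by simp) _ hγ))
  · exact Ideal.mul_mem_left _ _ (hXmem d (by simp) _ hδ)

end Root

end Summit.ResolutionOfSingularities.ResolutionOfSingularities.Theorems.WildQuotientResolution.JordanFive

end
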